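import Summits.Ventures.Crystal3D.Theorems.StickyWulffConstantCoaxialWallLawSkewRoots
import HarnessLib

/-!
# Skew roots of a translation offset, III: the steepest slot (`rise ≥ 1/√2`) and the defender's axis in case (B)
# (`rise ≥ sin θ / √2` for the best `{111}` normal)

HONEST FRAMING. Part of the venture `Summits/Ventures/Crystal3D` (cell `crystal3d-full`), helper
`--supports` the crux `CoaxialWallLaw` (stmt-Ventures-19481, `route-Ventures-StickyWulffConstant`),
REGISTERED line `WallLedgerF` (planner cf-p1 gen 16), open stub `stub_coaxialTwoSlabAdhesion`.
RUNG CREDIT ONLY — pure lattice geometry, nothing about packings.  The two orientation lemmas that the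
TRANSLATION half of the constant question (memo F-UNION §3, R41f(β)) needs beyond the union theorem
`…CoaxialWallLawUnion` (which keeps the given axis in cases (A), (B) and uses the crude rises `1/√3`, `½`):

* `exists_slot_rise_ge` — for EVERY orientation `A` some slot has rise `(A w)₂ ≥ 1/√2` (the two largest
  `|vᵢ|` of a unit vector sum to `≥ 1`): the root for 3-adically generic translations (case (A)) at flux `1`
  instead of `√(2/3)`;
* `exists_skewRoot_of_axis_sine` — in case (B) (a doubly skew cubic axis `k`) there are, for EVERY orientation `A`,
  a root slot `w` (with a τ-skew orthogonal slot) AND a frame `L'` of the SAME lattice (`L'·Λ₀ = A·Λ₀`, the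
  lattice symmetry of the cube vertex `sign v`, `exists_latticeFrame_of_cube`) with
  `(A w)₂ ≥ √(1 − ⟪L' e₃, e₃⟫²) / √2`:  the defender RE-PICKS the axis (the `{111}` normal closest to the
  vertical), and the elementary inequality `(a + b)² + (a + b + c)²/3 ≥ a² + b² + c²` (`a, b, c ≥ 0`, `c ≤ b`;
  `rise_sq_add_cos_sq_ge`) converts the absolute rise `(|v_k| + max |v_i|)/√2` into the sine law.  With END
  accounting at the own ball (19481-p1 g6) these give `½·sin θ` for translation pairs in cases (A) and (B); case
  (C) already has `(√3/2)·sin θ` (`…Union`).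

WHAT THIS IS NOT: anything about walls or packings; no rung is re-assembled here; F-C1 not moved.
-/

noncomputable section

namespace Summit.Ventures.Crystal3D.Theorems

open Summit.Ventures.Crystal3D Finset Matrix NearIdentity
open Literature.MathematicalPhysics.StatisticalMechanics (fccStacking)
open scoped InnerProductSpace

/-! ### 1. The steepest slot -/

/-- `x² + y² + z² = 1`, `|z| ≤ |x|`, `|z| ≤ |y|` ⇒ `|x| + |y| ≥ 1`. -/
theorem one_le_abs_add_abs {x y z : ℝ} (h : x ^ 2 + y ^ 2 + z ^ 2 = 1) (hzx : |z| ≤ |x|) (hzy : |z| ≤ |y|) :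
    1 ≤ |x| + |y| := by
  have hx := abs_nonneg x
  have hy := abs_nonneg y
  have hz := abs_nonneg z
  have hx2 : |x| ^ 2 = x ^ 2 := sq_abs x
  have hy2 : |y| ^ 2 = y ^ 2 := sq_abs y
  have hz2 : |z| ^ 2 = z ^ 2 := sq_abs z
  have hzz : |z| ^ 2 ≤ |x| * |y| := by rw [sq]; exact mul_le_mul hzx hzy hz hx
  have hsq : 1 ≤ (|x| + |y|) ^ 2 := by
    have e : (|x| + |y|) ^ 2 = |x| ^ 2 + 2 * (|x| * |y|) + |y| ^ 2 := by ring
    rw [e]; linarith [sq_nonneg z]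
  by_contra hlt'
  have hlt : |x| + |y| < 1 := not_le.mp hlt'
  have ht : 0 ≤ |x| + |y| := by positivity
  have : (|x| + |y|) * (|x| + |y|) < 1 * 1 := mul_lt_mul'' hlt hlt ht ht
  nlinarith [this]

/-- **The steepest slot.**  For every orientation `A` some slot has rise `(A w)₂ ≥ 1/√2`. -/
theorem exists_slot_rise_ge (A : EuclideanSpace ℝ (Fin 3) ≃ₗᵢ[ℝ] EuclideanSpace ℝ (Fin 3)) :
    ∃ w ∈ fccSlots, 1 / Real.sqrt 2 ≤ (A w) 2 := by
  have hv1 := sum_sq_cubicCoords_symm_e₃ A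
  set v := cubicCoords (A.symm (EuclideanSpace.single (2 : Fin 3) (1 : ℝ))) with hv
  -- the index of the smallest coordinate and the two others
  obtain ⟨k, i, l, hik, hlk, hil, hki, hkl⟩ : ∃ k i l : Fin 3, i ≠ k ∧ l ≠ k ∧ i ≠ l ∧
      |v k| ≤ |v i| ∧ |v k| ≤ |v l| := by
    rcases le_total |v 0| |v 1| with h01 | h01 <;> rcases le_total |v 0| |v 2| with h02 | h02 <;>
      rcases le_total |v 1| |v 2| with h12 | h12
    · exact ⟨0, 1, 2, by decide, by decide, by decide, h01, h02⟩
    · exact ⟨0, 1, 2, by decide, by decide, by decide, h01, h02⟩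
    · exact ⟨2, 0, 1, by decide, by decide, by decide, h02, h02.trans h01⟩
    · exact ⟨2, 0, 1, by decide, by decide, by decide, h02, h12⟩
    · exact ⟨1, 0, 2, by decide, by decide, by decide, h01, h12⟩
    · exact ⟨1, 0, 2, by decide, by decide, by decide, h01, h01.trans h02⟩
    · exact ⟨1, 0, 2, by decide, by decide, by decide, h01, h12⟩
    · exact ⟨2, 0, 1, by decide, by decide, by decide, h02, h12⟩
  have hsq : v i ^ 2 + v l ^ 2 + v k ^ 2 = 1 := by
    rw [← sum_three_perm (fun j => v j ^ 2) i l k hil.symm (Ne.symm hik) hlk]; exact hv1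
  have hone : 1 ≤ |v i| + |v l| := one_le_abs_add_abs hsq hki hkl
  -- the slot with the signs of `v i`, `v l`
  obtain ⟨m, hmi, hml, hm0⟩ := slotInt_of_signs i l hil (decide (0 ≤ v i)) (decide (0 ≤ v l))
  refine ⟨slotSite m, slotSite_mem m, ?_⟩
  rw [apply_two_slotSite, ← hv]
  have hsum : slotVec m ⬝ᵥ v = ((slotInt m i : ℝ) * v i + (slotInt m l : ℝ) * v l) / Real.sqrt 2 := by
    simp only [dotProduct, slotVec]
    rw [sum_fin_three_of_support _ i l hil (fun j hj hj' => by rw [hm0 j hj hj']; simp)]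
    ring
  rw [hsum]
  have ei : (slotInt m i : ℝ) * v i = |v i| := by
    by_cases h : 0 ≤ v i
    · rw [hmi, if_pos (decide_eq_true h), abs_of_nonneg h]; simp
    · rw [hmi, if_neg (by simpa using h), abs_of_neg (lt_of_not_ge h)]; simp
  have el : (slotInt m l : ℝ) * v l = |v l| := by
    by_cases h : 0 ≤ v l
    · rw [hml, if_pos (decide_eq_true h), abs_of_nonneg h]; simp
    · rw [hml, if_neg (by simpa using h), abs_of_neg (lt_of_not_ge h)]; simp
  rw [ei, el]
  have hs0 : 0 < Real.sqrt 2 := by positivity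
  exact div_le_div_of_nonneg_right hone hs0.le

/-! ### 2. Case (B) with the defender's axis -/

/-- `a, b, c ≥ 0`, `c ≤ b`, `a² + b² + c² = 1` ⇒ `1 − (a + b + c)²/3 ≤ (a + b)²`. -/
theorem rise_sq_add_cos_sq_ge {a b c : ℝ} (ha : 0 ≤ a) (hb : 0 ≤ b) (hc : 0 ≤ c) (hcb : c ≤ b)
    (h : a ^ 2 + b ^ 2 + c ^ 2 = 1) : 1 - (a + b + c) ^ 2 / 3 ≤ (a + b) ^ 2 := by
  nlinarith [mul_nonneg ha hb, mul_nonneg ha hc, mul_le_mul_of_nonneg_left hcb hc, sq_nonneg c]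

/-- **Case (B) with the defender's axis.**  If all four `p_k ± p_i` (`i ≠ k`) are non-integers
(`p = √2 · cubicCoords τ`), then for every orientation `A` there are a slot `w` with a τ-skew orthogonal slot
`s` and a frame `L'` of the same lattice (`L'·Λ₀ = A·Λ₀`) with `(A w)₂ ≥ √(1 − ⟪L' e₃, e₃⟫²)/√2`. -/
theorem exists_skewRoot_of_axis_sine (τ : EuclideanSpace ℝ (Fin 3)) (k : Fin 3)
    (hk : ∀ i : Fin 3, i ≠ k →
      (¬ ∃ z : ℤ, Real.sqrt 2 * cubicCoords τ k + Real.sqrt 2 * cubicCoords τ i = z) ∧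
      (¬ ∃ z : ℤ, Real.sqrt 2 * cubicCoords τ k - Real.sqrt 2 * cubicCoords τ i = z))
    (A : EuclideanSpace ℝ (Fin 3) ≃ₗᵢ[ℝ] EuclideanSpace ℝ (Fin 3)) :
    ∃ w ∈ fccSlots, ∃ s ∈ fccSlots, ⟪w, s⟫_ℝ = 0 ∧ (∀ z : ℤ, ⟪τ, s⟫_ℝ ≠ (z : ℝ) / 2) ∧
      ∃ L' : EuclideanSpace ℝ (Fin 3) ≃ₗᵢ[ℝ] EuclideanSpace ℝ (Fin 3),
        L' '' fccStacking 1 (Real.sqrt (2 / 3)) = A '' fccStacking 1 (Real.sqrt (2 / 3)) ∧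
        Real.sqrt (1 - ⟪L' (EuclideanSpace.single (2 : Fin 3) (1 : ℝ)),
            EuclideanSpace.single (2 : Fin 3) (1 : ℝ)⟫_ℝ ^ 2) / Real.sqrt 2 ≤ (A w) 2 := by
  have hadj : ∀ x y : EuclideanSpace ℝ (Fin 3), ⟪A x, y⟫_ℝ = ⟪x, A.symm y⟫_ℝ := fun x y => by
    rw [← A.inner_map_map x (A.symm y), A.apply_symm_apply]
  have hv1 := sum_sq_cubicCoords_symm_e₃ A
  set v := cubicCoords (A.symm (EuclideanSpace.single (2 : Fin 3) (1 : ℝ))) with hv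
  -- the other two axes, the larger coordinate first
  obtain ⟨i, l, hik, hlk, hil⟩ := (by decide : ∀ k : Fin 3, ∃ i l : Fin 3, i ≠ k ∧ l ≠ k ∧ i ≠ l) k
  obtain ⟨i, l, hik, hlk, hil, hli⟩ : ∃ i l : Fin 3, i ≠ k ∧ l ≠ k ∧ i ≠ l ∧ |v l| ≤ |v i| := by
    rcases le_total |v l| |v i| with h | h
    · exact ⟨i, l, hik, hlk, hil, h⟩
    · exact ⟨l, i, hlk, hik, Ne.symm hil, h⟩
  have hsq : v k ^ 2 + v i ^ 2 + v l ^ 2 = 1 := by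
    rw [← sum_three_perm (fun j => v j ^ 2) k i l hik hlk hil]; exact hv1
  -- the root slot with the signs of `v k`, `v i`, and its partner
  obtain ⟨m, hmk, hmi, hm0⟩ := slotInt_of_signs k i (Ne.symm hik) (decide (0 ≤ v k)) (decide (0 ≤ v i))
  have hmk0 : slotInt m k ≠ 0 := by rw [hmk]; split_ifs <;> decide
  obtain ⟨m', hmm', hsupp⟩ := slotInt_partner m
  -- the sign vector of `v` and its lattice frame
  obtain ⟨c, hc0, hc1, hc2⟩ := exists_cubeInt_eq (if 0 ≤ v 0 then 1 else -1) (if 0 ≤ v 1 then 1 else -1)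
    (if 0 ≤ v 2 then 1 else -1) (by split_ifs <;> simp) (by split_ifs <;> simp) (by split_ifs <;> simp)
  have hcabs : ∀ j : Fin 3, (cubeInt c j : ℝ) * v j = |v j| := by
    intro j
    fin_cases j <;> simp only [Fin.isValue, Fin.zero_eta, Fin.mk_one, Fin.reduceFinMk]
    · rw [hc0]; split_ifs with h
      · rw [abs_of_nonneg h, one_mul]
      · rw [abs_of_neg (lt_of_not_ge h)]; ring
    · rw [hc1]; split_ifs with h
      · rw [abs_of_nonneg h, one_mul]
      · rw [abs_of_neg (lt_of_not_ge h)]; ring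
    · rw [hc2]; split_ifs with h
      · rw [abs_of_nonneg h, one_mul]
      · rw [abs_of_neg (lt_of_not_ge h)]; ring
  obtain ⟨G, hG, κ, hκ, hcoord⟩ := exists_latticeFrame_of_cube c
  refine ⟨slotSite m, slotSite_mem m, slotSite m', slotSite_mem m', by rw [inner_slotSite, hmm']; simp,
    skew_of_axis τ k hk m' (hsupp k hmk0), G.trans A, by rw [LinearIsometryEquiv.coe_trans, Set.image_comp, hG], ?_⟩
  -- `⟪L' e₃, e₃⟫ = κ · (|v₀| + |v₁| + |v₂|)` with `3 κ² = 1`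
  have hκ2 : 3 * κ ^ 2 = 1 := by
    have hn := norm_sq_eq_cubicCoords (G (EuclideanSpace.single (2 : Fin 3) (1 : ℝ)))
    rw [LinearIsometryEquiv.norm_map, PiLp.norm_single, norm_one, one_pow] at hn
    simp only [dotProduct, Fin.sum_univ_three] at hn
    rw [hcoord 0, hcoord 1, hcoord 2] at hn
    have h0 := cubeInt_pm_one c 0
    have h1 := cubeInt_pm_one c 1
    have h2 := cubeInt_pm_one c 2
    have e0 : ((cubeInt c 0 : ℝ)) ^ 2 = 1 := by rcases h0 with h | h <;> rw [h] <;> norm_num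
    have e1 : ((cubeInt c 1 : ℝ)) ^ 2 = 1 := by rcases h1 with h | h <;> rw [h] <;> norm_num
    have e2 : ((cubeInt c 2 : ℝ)) ^ 2 = 1 := by rcases h2 with h | h <;> rw [h] <;> norm_num
    nlinarith [hn, e0, e1, e2]
  have hinner : ⟪(G.trans A) (EuclideanSpace.single (2 : Fin 3) (1 : ℝ)),
      EuclideanSpace.single (2 : Fin 3) (1 : ℝ)⟫_ℝ = κ * (|v 0| + |v 1| + |v 2|) := by
    rw [LinearIsometryEquiv.trans_apply, hadj, inner_eq_cubicCoords, ← hv]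
    simp only [dotProduct, Fin.sum_univ_three]
    rw [hcoord 0, hcoord 1, hcoord 2, ← hcabs 0, ← hcabs 1, ← hcabs 2]; ring
  -- the rise of the root
  rw [apply_two_slotSite, ← hv]
  have hsum : slotVec m ⬝ᵥ v = ((slotInt m k : ℝ) * v k + (slotInt m i : ℝ) * v i) / Real.sqrt 2 := by
    simp only [dotProduct, slotVec]
    rw [sum_fin_three_of_support _ k i (Ne.symm hik) (fun j hj hj' => by rw [hm0 j hj hj']; simp)]
    ring
  have ek : (slotInt m k : ℝ) * v k = |v k| := by
    by_cases h : 0 ≤ v k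
    · rw [hmk, if_pos (decide_eq_true h), abs_of_nonneg h]; simp
    · rw [hmk, if_neg (by simpa using h), abs_of_neg (lt_of_not_ge h)]; simp
  have ei : (slotInt m i : ℝ) * v i = |v i| := by
    by_cases h : 0 ≤ v i
    · rw [hmi, if_pos (decide_eq_true h), abs_of_nonneg h]; simp
    · rw [hmi, if_neg (by simpa using h), abs_of_neg (lt_of_not_ge h)]; simp
  rw [hsum, ek, ei, hinner]
  have hs0 : 0 < Real.sqrt 2 := by positivity
  apply div_le_div_of_nonneg_right _ hs0.le
  -- `√(1 − κ²(Σ|vⱼ|)²) ≤ |v k| + |v i|`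
  have habs : |v 0| + |v 1| + |v 2| = |v k| + |v i| + |v l| := sum_three_perm (fun j => |v j|) k i l hik hlk hil
  have hkey : 1 - (κ * (|v 0| + |v 1| + |v 2|)) ^ 2 ≤ (|v k| + |v i|) ^ 2 := by
    rw [habs, mul_pow, show κ ^ 2 = 1 / 3 by linarith [hκ2]]
    have := rise_sq_add_cos_sq_ge (abs_nonneg (v k)) (abs_nonneg (v i)) (abs_nonneg (v l)) hli
      (by rw [sq_abs, sq_abs, sq_abs]; exact hsq)
    linarith [this]
  calc Real.sqrt (1 - (κ * (|v 0| + |v 1| + |v 2|)) ^ 2)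
      ≤ Real.sqrt ((|v k| + |v i|) ^ 2) := Real.sqrt_le_sqrt hkey
    _ = |v k| + |v i| := Real.sqrt_sq (by positivity)

end Summit.Ventures.Crystal3D.Theorems

end
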